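import Mathlib
import Literature.MathematicalPhysics.QuantumFieldTheory.Luscher2010.TrivializingMaps
import Literature.MathematicalPhysics.QuantumFieldTheory.Luscher2010.FlowActionSeries
import Literature.Probability.MarkovChains.DoeblinMinorization
import Summits.Ventures.LatticeQCDFlow.TrivializingMaps.Truncation
import Summits.Ventures.LatticeQCDFlow.TrivializingMaps.TruncatedMapLogWeight
import Summits.Ventures.LatticeQCDFlow.TrivializingMaps.SeriesUniqueness
import Summits.Ventures.LatticeQCDFlow.TrivializingMaps.ExtensiveDefectReduction
import Summits.Ventures.LatticeQCDFlow.TrivializingMaps.TruncatedWilsonFlowSampler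
import Summits.Ventures.LatticeQCDFlow.Exactness.ApproxTrivializingSampler
import HarnessLib

/-!
# Log-depth law for the exact Wilson-flow sampler, conditional on the geometric gradient bound (Theorem A)

HONEST FRAMING: exact (Metropolis-corrected) sampling algorithms for lattice gauge theory; figures of merit are
autocorrelation/cost numbers at stated couplings and volumes; no continuum-physics claim.

Venture `LatticeQCDFlow` (cell pub-lqcd), topic `TrivializingMaps`, FANOUT row 28 (theory-1), route R-T1
(Lüscher's perturbative trivializing maps; typed targets of `Truncation.lean`).  `TruncatedWilsonFlowSampler.lean`
certifies, UNCONDITIONALLY, the acceptance / Doeblin / mixing floor `e^{-M}`, `M = 2|β|^{N+2} b_N |E|/(N+2)`, of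
the exact order-`N` Wilson-flow sampler at coupling `β` in volume `|E| = d L^d`, with compactness constants `b_N`
of unspecified growth in `N`.  This file answers the venture's cost question ("how must training cost scale
with volume for fixed acceptance") on the CONSTRUCTIVE side, CONDITIONALLY on the one analytic statement the
cell has isolated as its Theorem A — the geometric gradient bound `LuscherGeometricGradientBound d n`
(`Truncation.lean` §6, tagged `@[conjecture]` there: `|∂^a_e S̃^{(k)}| ≤ C ρ^{-k}` uniformly in the volume, for
every smooth solution of Lüscher's recursion for `S_W`; Lüscher 2010 §4.5(b) observes `ρ > 1` is compatible with
his computations but proves nothing):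

* `flowSampler_of_defect_le` — the cell's chain as ONE reusable step, for an arbitrary smooth action `S`:
  a sup bound `K` on the order-`N` defect density `𝓥_S S̃^{(N)}` over `SU(n)^E` gives an EXACT sampler
  for `𝒵⁻¹e^{-S}D[U]` with weight `e^{-M} ≤ w ≤ e^{M}`, acceptance `≥ e^{-M}` from every configuration,
  Doeblin constant `e^{-M}` and geometric mixing `(1 - e^{-M})ᵗ`, for every `M ≥ 2K/(N+2)`;
* `abs_luscherV_wilson_le` — a uniform gradient bound `G` on `f` gives
  `sup |𝓥_{S_W} f| ≤ dim · c_W · G · |E|`;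
* `truncatedWilsonFlowSampler_of_geometric` — under Theorem A: the floor holds with
  `M = 2|β|^{N+2} D ρ^{-N} |E|/(N+2)`, `D = D(d,n) ≥ 0`, i.e. `b_N ≤ D ρ^{-N}` (geometric in `N`);
* `logDepthWilsonFlowSampler_of_geometric` — **the log-depth law**: under Theorem A, for every `0 < η < 1`,
  every target `ε > 0`, every coupling in the geometric regime `|β| ≤ (1 - η) ρ` and every volume, ANY
  order `N ≥ log(D ρ² |E| / ε) / log(1/(1 - η))` — logarithmic in the number of links — yields an exact
  sampler with acceptance `≥ e^{-ε}` from every configuration, Doeblin constant `e^{-ε}` and mixing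
  `(1 - e^{-ε})ᵗ`, uniformly in the volume (`mul_pow_le_of_log_div_le` is the elementary threshold computation).

So, conditionally on Theorem A and inside its radius, "fixed acceptance" costs a truncation order (the depth of
the perturbative map) growing like `log |E|`, not like `|E|`; the cost of EVALUATING an order-`N` map (number of
link polynomials, their footprint `linkBall (N+1)`, `LuscherFootprintLinear`) is the implementation side and is
not priced here.  Nothing in this file asserts Theorem A; the abelian (`U(1)`) analogue of Theorem A is a tree
theorem (`AbelianGeometricBound.lean`, `abelianGeometricGradientBound`), the non-abelian statement is open
(THEORY-1.md §12 is a paper proof sketch).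
The opposite direction — that below log-depth, or for volume-uniform maps of bounded cost, acceptance MUST
degrade — is the cell's separate lower-bound line (theory-2) and is not claimed.

References: M. Lüscher, Commun. Math. Phys. 293 (2010) 899–919 [Luscher2010Trivializing, arXiv:0907.5491],
§3.2 eq. (3.9), §4.3 eqs. (4.12)–(4.15), §4.4 eq. (4.17), §4.5(b)(c), §6; S. Meyn, R. Tweedie, Markov Chains
and Stochastic Stability (2009), Thm 16.2.4.  Printed counterparts named only.
-/

namespace Summit.Ventures.LatticeQCDFlow.TrivializingMaps

open MeasureTheory ProbabilityTheory
open Literature.MathematicalPhysics.QuantumFieldTheory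
open Literature.MathematicalPhysics.QuantumFieldTheory.Luscher2010
open Summit.Ventures.LatticeQCDFlow.Exactness
open scoped ENNReal Matrix Matrix.Norms.Frobenius ContDiff

/-! ## §1. From a sup bound on the defect density to the exact sampler (general smooth action) -/

section Generic

variable {d L n : ℕ} [NeZero L]

/-- **Defect bound ⇒ exact sampler with floor `e^{-2K/(N+2)}`** (the cell's chain, general smooth action `S`).
If `S̃^{(k)}` is a smooth solution of Lüscher's recursion for `S`, `sup_{SU(n)^E} |𝓥_S S̃^{(N)}| ≤ K`,
`𝓕` is a flow of `Z_t = -∂S̃^{[N]}_t` with output law `q = (𝓕_1)_* D[V]` and `M ≥ 2K/(N+2)`, then there is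
a measurable weight `e^{-M} ≤ w ≤ e^{M}` with `w · q = 𝒵⁻¹e^{-S}D[U]` such that `indepMH q w` is exact,
accepts from every configuration with probability `≥ e^{-M}`, obeys Doeblin with constant `e^{-M}` and
mixes geometrically.
[cite: Luscher2010Trivializing, §3.2 eq. (3.9), §4.1 eqs. (4.1)–(4.3), §4.3, §6] -/
theorem flowSampler_of_defect_le (B : SuBasis n) {S : AmbConfig d L n → ℝ} (hS : ContDiff ℝ ∞ S)
    {Sk : ℕ → AmbConfig d L n → ℝ} (hSk : ∀ k, ContDiff ℝ ∞ (Sk k)) {c : ℕ → ℝ}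
    (hser : IsLuscherSeries B S Sk c) (N : ℕ) {K : ℝ}
    (hK : ∀ U : GaugeConfig d L (Matrix.specialUnitaryGroup (Fin n) ℂ),
      |luscherV B S (Sk N) (WilsonFlow.coeConfig U)| ≤ K)
    {Φ : ℝ → GaugeConfig d L (Matrix.specialUnitaryGroup (Fin n) ℂ) →
      GaugeConfig d L (Matrix.specialUnitaryGroup (Fin n) ℂ)}
    (hΦ : IsFlowMap (fun t W => -linkGrad B (truncFlowAction Sk t N) W) Φ)
    (q : Measure (GaugeConfig d L (Matrix.specialUnitaryGroup (Fin n) ℂ))) [IsProbabilityMeasure q]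
    (hq : q = Measure.map (Φ 1) (trivialMeasure (Matrix.specialUnitaryGroup (Fin n) ℂ) d L))
    {M : ℝ} (hM : 2 * K / (N + 2) ≤ M) :
    ∃ w : GaugeConfig d L (Matrix.specialUnitaryGroup (Fin n) ℂ) → ℝ, Measurable w ∧
      (∀ U, Real.exp (-M) ≤ w U) ∧ (∀ U, w U ≤ Real.exp M) ∧
      (q.withDensity fun U => ENNReal.ofReal (w U)) =
        boltzmannMeasure (fun U : GaugeConfig d L (Matrix.specialUnitaryGroup (Fin n) ℂ) =>
          S (WilsonFlow.coeConfig U)) ∧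
      Kernel.Invariant (indepMH q w)
        (boltzmannMeasure fun U : GaugeConfig d L (Matrix.specialUnitaryGroup (Fin n) ℂ) =>
          S (WilsonFlow.coeConfig U)) ∧
      (∀ U, ENNReal.ofReal (Real.exp (-M)) ≤ imhAcceptMass q w U) ∧
      (∀ (U : GaugeConfig d L (Matrix.specialUnitaryGroup (Fin n) ℂ))
        (A : Set (GaugeConfig d L (Matrix.specialUnitaryGroup (Fin n) ℂ))), MeasurableSet A →
        ENNReal.ofReal (Real.exp (-M)) *
            boltzmannMeasure (fun U : GaugeConfig d L (Matrix.specialUnitaryGroup (Fin n) ℂ) =>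
              S (WilsonFlow.coeConfig U)) A ≤ indepMH q w U A) ∧
      ∀ (μ : Measure (GaugeConfig d L (Matrix.specialUnitaryGroup (Fin n) ℂ))) [IsProbabilityMeasure μ]
        (t : ℕ) (A : Set (GaugeConfig d L (Matrix.specialUnitaryGroup (Fin n) ℂ))),
        |((fun m : Measure (GaugeConfig d L (Matrix.specialUnitaryGroup (Fin n) ℂ)) =>
              m.bind (indepMH q w))^[t] μ).real A -
            (boltzmannMeasure fun U : GaugeConfig d L (Matrix.specialUnitaryGroup (Fin n) ℂ) =>
              S (WilsonFlow.coeConfig U)).real A| ≤ (1 - Real.exp (-M)) ^ t := by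
  have hF := contDiff_truncFlowAction_param hSk N
  have hK0 : 0 ≤ K := (abs_nonneg _).trans (hK fun _ => 1)
  have hM0 : 0 ≤ M := by
    have : 0 ≤ 2 * K / (N + 2) := by positivity
    exact this.trans hM
  have hg : IntervalIntegrable (fun t : ℝ => t ^ (N + 1) * K) volume 0 1 :=
    ((continuous_pow (N + 1)).mul continuous_const).intervalIntegrable 0 1
  -- the pulled-back log-weight of the order-`N` map oscillates by at most `2K/(N+2) ≤ M`
  have hosc := logWeight_osc_le_of_defect_le B hS (F := fun t => truncFlowAction Sk t N) hF hΦ hg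
    (fun t ht U => abs_truncation_defect_le B hS hSk hser N hK t ht U)
  have hoscM : ∀ V V' : GaugeConfig d L (Matrix.specialUnitaryGroup (Fin n) ℂ),
      |((∫ s in (0 : ℝ)..1, linkDiv B (fun W => -linkGrad B (truncFlowAction Sk s N) W)
            (WilsonFlow.coeConfig (Φ s V))) - S (WilsonFlow.coeConfig (Φ 1 V))) -
        ((∫ s in (0 : ℝ)..1, linkDiv B (fun W => -linkGrad B (truncFlowAction Sk s N) W)
            (WilsonFlow.coeConfig (Φ s V'))) - S (WilsonFlow.coeConfig (Φ 1 V')))| ≤ M := fun V V' =>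
    ((hosc V V').trans_eq (two_mul_intervalIntegral_pow_mul N K)).trans hM
  obtain ⟨w, hw, hlo, hhi, hπ, hinv, hacc, hdoeb⟩ :=
    flowSampler_exact_doeblin_of_osc jacobianFormula_holds B hS (F := fun t => truncFlowAction Sk t N)
      hF hΦ hoscM q hq
  refine ⟨w, hw, hlo, hhi, hπ, hinv, hacc, fun U A hA => hdoeb U hA, fun μ _ t A => ?_⟩
  -- Doeblin ⇒ geometric convergence in total variation, set by set
  haveI : Fact (Measurable w) := ⟨hw⟩
  have hS'c : Continuous fun U : GaugeConfig d L (Matrix.specialUnitaryGroup (Fin n) ℂ) =>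
      S (WilsonFlow.coeConfig U) := hS.continuous.comp WilsonFlow.continuous_coeConfig
  haveI := isProbabilityMeasure_boltzmannMeasure (d := d) (L := L) hS'c
  have hε1 : ENNReal.ofReal (Real.exp (-M)) ≤ 1 :=
    ENNReal.ofReal_le_one.2 (Real.exp_le_one_iff.2 (by linarith))
  have h := Literature.Probability.MarkovChains.Doeblin.doeblin_iterate_sub_invariant_le
    (κ := indepMH q w) (ε := ENNReal.ofReal (Real.exp (-M)))
    (fun x B hB => hdoeb x hB) hε1 hinv μ t A
  rwa [ENNReal.toReal_ofReal (Real.exp_pos _).le] at h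

/-- **Gradient bound ⇒ defect bound.**  If the unit-direction link gradients of `S_W` are bounded by `c_W` and
those of `f` along the generators of `B` by `G`, then `sup |𝓥_{S_W} f| ≤ dim_ℝ M_n(ℂ) · c_W · G · |E|`
(at most `dim` colours per link — `suBasis_card_le` — and `|E|` links). [cite: Luscher2010Trivializing, §4.3
eq. (4.15), App. A] -/
theorem abs_luscherV_wilson_le (B : SuBasis n) {cW G : ℝ} (hcW : 0 ≤ cW) (hG : 0 ≤ G)
    (hW : ∀ (e : Edge d L) (Y : Matrix (Fin n) (Fin n) ℂ), Y ∈ suAlgebra n → ‖Y‖ ≤ 1 →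
      ∀ U : GaugeConfig d L (Matrix.specialUnitaryGroup (Fin n) ℂ),
        |linkDeriv e Y (ambWilsonAction : AmbConfig d L n → ℝ) (WilsonFlow.coeConfig U)| ≤ cW)
    {f : AmbConfig d L n → ℝ}
    (hf : ∀ (U : GaugeConfig d L (Matrix.specialUnitaryGroup (Fin n) ℂ)) (e : Edge d L) (a : B.ι),
      |linkDeriv e (B.T a) f (WilsonFlow.coeConfig U)| ≤ G)
    (U : GaugeConfig d L (Matrix.specialUnitaryGroup (Fin n) ℂ)) :
    |luscherV B ambWilsonAction f (WilsonFlow.coeConfig U)| ≤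
      Module.finrank ℝ (Matrix (Fin n) (Fin n) ℂ) * (cW * G) * Fintype.card (Edge d L) := by
  unfold luscherV
  have hWG : 0 ≤ cW * G := mul_nonneg hcW hG
  calc |∑ e : Edge d L, ∑ a : B.ι, linkDeriv e (B.T a) (ambWilsonAction : AmbConfig d L n → ℝ)
            (WilsonFlow.coeConfig U) * linkDeriv e (B.T a) f (WilsonFlow.coeConfig U)|
      ≤ ∑ e : Edge d L, |∑ a : B.ι, linkDeriv e (B.T a) (ambWilsonAction : AmbConfig d L n → ℝ)
            (WilsonFlow.coeConfig U) * linkDeriv e (B.T a) f (WilsonFlow.coeConfig U)| :=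
        Finset.abs_sum_le_sum_abs _ _
    _ ≤ ∑ _e : Edge d L, (Module.finrank ℝ (Matrix (Fin n) (Fin n) ℂ) : ℝ) * (cW * G) :=
        Finset.sum_le_sum fun e _ => by
          calc |∑ a : B.ι, linkDeriv e (B.T a) (ambWilsonAction : AmbConfig d L n → ℝ)
                    (WilsonFlow.coeConfig U) * linkDeriv e (B.T a) f (WilsonFlow.coeConfig U)|
              ≤ ∑ a : B.ι, |linkDeriv e (B.T a) (ambWilsonAction : AmbConfig d L n → ℝ)
                    (WilsonFlow.coeConfig U) * linkDeriv e (B.T a) f (WilsonFlow.coeConfig U)| :=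
                Finset.abs_sum_le_sum_abs _ _
            _ ≤ ∑ _a : B.ι, cW * G := Finset.sum_le_sum fun a _ => by
                rw [abs_mul]
                exact mul_le_mul (hW e (B.T a) (B.mem a) (suBasis_norm_le_one B a) U) (hf U e a)
                  (abs_nonneg _) hcW
            _ = Fintype.card B.ι * (cW * G) := by rw [Finset.sum_const, nsmul_eq_mul, Finset.card_univ]
            _ ≤ Module.finrank ℝ (Matrix (Fin n) (Fin n) ℂ) * (cW * G) := by
                gcongr
                exact_mod_cast suBasis_card_le B
    _ = Module.finrank ℝ (Matrix (Fin n) (Fin n) ℂ) * (cW * G) * Fintype.card (Edge d L) := by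
        rw [Finset.sum_const, nsmul_eq_mul, Finset.card_univ]; ring

omit [NeZero L] in
/-- The threshold computation: for `0 < η < 1`, `0 < ε`, `0 ≤ A` and `N ≥ log(A/ε) / log(1/(1-η))`,
`A (1-η)^N ≤ ε`. [folklore] -/
theorem mul_pow_le_of_log_div_le {A ε η : ℝ} (hA : 0 ≤ A) (hε : 0 < ε) (hη0 : 0 < η) (hη1 : η < 1)
    {N : ℕ} (hN : Real.log (A / ε) / -Real.log (1 - η) ≤ N) : A * (1 - η) ^ N ≤ ε := by
  have h1 : 0 < 1 - η := by linarith
  have hnl : 0 < -Real.log (1 - η) := by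
    have := Real.log_neg h1 (by linarith)
    linarith
  rcases hA.eq_or_lt with h | hA'
  · rw [← h, zero_mul]; exact hε.le
  · have h2 : Real.log (A / ε) ≤ N * -Real.log (1 - η) := (div_le_iff₀ hnl).1 hN
    rw [Real.log_div hA'.ne' hε.ne'] at h2
    have h3 : Real.log (A * (1 - η) ^ N) ≤ Real.log ε := by
      rw [Real.log_mul hA'.ne' (pow_pos h1 N).ne', Real.log_pow]
      linarith
    exact (Real.log_le_log_iff (mul_pos hA' (pow_pos h1 N)) hε).1 h3

end Generic

/-! ## §2. Under Theorem A: `b_N ≤ D ρ^{-N}`, and the log-depth law -/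

section Geometric

/-- **The exact order-`N` Wilson-flow sampler under the geometric gradient bound.**  If Theorem A
(`LuscherGeometricGradientBound d n`: `|∂^a_e S̃^{(k)}| ≤ C ρ^{-k}` volume-uniformly) holds, then there are
`ρ > 0` (its radius) and `D = D(d,n) ≥ 0` such that the guarantee of `truncatedWilsonFlowSampler` holds with
`b_N` replaced by `D ρ^{-N}`: for every `β`, `L`, basis, smooth solution of the recursion for `β S_W`, flow `𝓕`
of `-∂S̃^{[N]}_t` with output law `q`, and every `M ≥ 2|β|^{N+2} D ρ^{-N} |E|/(N+2)` — exactness, weight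
window `[e^{-M}, e^{M}]`, acceptance `≥ e^{-M}` everywhere, Doeblin `e^{-M}`, mixing `(1 - e^{-M})ᵗ`.
[cite: Luscher2010Trivializing, §4.3–§4.5, §6] -/
theorem truncatedWilsonFlowSampler_of_geometric {d n : ℕ} (h : LuscherGeometricGradientBound d n) :
    ∃ ρ : ℝ, 0 < ρ ∧ ∃ D : ℝ, 0 ≤ D ∧
    ∀ (N : ℕ) (β : ℝ) (L : ℕ) [NeZero L] (B : SuBasis n) (Sk : ℕ → AmbConfig d L n → ℝ)
      (c : ℕ → ℝ), (∀ k, ContDiff ℝ ∞ (Sk k)) → IsLuscherSeries B (fun W => β * ambWilsonAction W) Sk c →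
      ∀ (Φ : ℝ → GaugeConfig d L (Matrix.specialUnitaryGroup (Fin n) ℂ) →
          GaugeConfig d L (Matrix.specialUnitaryGroup (Fin n) ℂ)),
        IsFlowMap (fun t W => -linkGrad B (truncFlowAction Sk t N) W) Φ →
      ∀ (q : Measure (GaugeConfig d L (Matrix.specialUnitaryGroup (Fin n) ℂ))) [IsProbabilityMeasure q],
        q = Measure.map (Φ 1) (trivialMeasure (Matrix.specialUnitaryGroup (Fin n) ℂ) d L) →
      ∀ M : ℝ, 2 * (|β| ^ (N + 2) * (D * ρ⁻¹ ^ N) * Fintype.card (Edge d L)) / (N + 2) ≤ M →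
      ∃ w : GaugeConfig d L (Matrix.specialUnitaryGroup (Fin n) ℂ) → ℝ, Measurable w ∧
        (∀ U, Real.exp (-M) ≤ w U) ∧ (∀ U, w U ≤ Real.exp M) ∧
        (q.withDensity fun U => ENNReal.ofReal (w U)) =
          boltzmannMeasure (fun U : GaugeConfig d L (Matrix.specialUnitaryGroup (Fin n) ℂ) =>
            β * ambWilsonAction (WilsonFlow.coeConfig U)) ∧
        Kernel.Invariant (indepMH q w)
          (boltzmannMeasure fun U : GaugeConfig d L (Matrix.specialUnitaryGroup (Fin n) ℂ) =>
            β * ambWilsonAction (WilsonFlow.coeConfig U)) ∧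
        (∀ U, ENNReal.ofReal (Real.exp (-M)) ≤ imhAcceptMass q w U) ∧
        (∀ (U : GaugeConfig d L (Matrix.specialUnitaryGroup (Fin n) ℂ))
          (A : Set (GaugeConfig d L (Matrix.specialUnitaryGroup (Fin n) ℂ))), MeasurableSet A →
          ENNReal.ofReal (Real.exp (-M)) *
              boltzmannMeasure (fun U : GaugeConfig d L (Matrix.specialUnitaryGroup (Fin n) ℂ) =>
                β * ambWilsonAction (WilsonFlow.coeConfig U)) A ≤ indepMH q w U A) ∧
        ∀ (μ : Measure (GaugeConfig d L (Matrix.specialUnitaryGroup (Fin n) ℂ))) [IsProbabilityMeasure μ]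
          (t : ℕ) (A : Set (GaugeConfig d L (Matrix.specialUnitaryGroup (Fin n) ℂ))),
          |((fun m : Measure (GaugeConfig d L (Matrix.specialUnitaryGroup (Fin n) ℂ)) =>
                m.bind (indepMH q w))^[t] μ).real A -
              (boltzmannMeasure fun U : GaugeConfig d L (Matrix.specialUnitaryGroup (Fin n) ℂ) =>
                β * ambWilsonAction (WilsonFlow.coeConfig U)).real A| ≤ (1 - Real.exp (-M)) ^ t := by
  obtain ⟨ρ, hρ, C, hC⟩ := h
  obtain ⟨cW, hcW0, hcW⟩ := wilsonGradBound d n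
  refine ⟨ρ, hρ, Module.finrank ℝ (Matrix (Fin n) (Fin n) ℂ) * (cW * max C 0), by positivity, ?_⟩
  intro N β L _ B Sk c hSk hser Φ hΦ q _ hq M hM
  have hS : ContDiff ℝ ∞ (fun W : AmbConfig d L n => β * ambWilsonAction W) :=
    contDiff_const.mul contDiff_ambWilsonAction
  -- Theorem A for the constructed series `S̃_W^{(k)}` of `S_W`
  have hG : ∀ (U : GaugeConfig d L (Matrix.specialUnitaryGroup (Fin n) ℂ)) (e : Edge d L) (a : B.ι),
      |linkDeriv e (B.T a) (wilsonSk d L B N) (WilsonFlow.coeConfig U)| ≤ max C 0 * ρ⁻¹ ^ N :=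
    fun U e a => (hC L B (wilsonSk d L B) (wilsonConst d L B) (contDiff_wilsonSk B)
      (isLuscherSeries_wilsonSk B) N U e a).trans (by gcongr; exact le_max_left _ _)
  -- compare the given series with the constructed, `β`-scaled one (uniqueness of gradients) and rescale
  have hser' : IsLuscherSeries B (fun W => β * ambWilsonAction W)
      (fun k W => β ^ (k + 1) * wilsonSk d L B k W) (fun k => β ^ (k + 1) * wilsonConst d L B k) :=
    (isLuscherSeries_wilsonSk B).smul β
  have hsm' : ∀ k, ContDiff ℝ ∞ (fun W : AmbConfig d L n => β ^ (k + 1) * wilsonSk d L B k W) :=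
    fun k => contDiff_const.mul (contDiff_wilsonSk B k)
  have hK : ∀ U : GaugeConfig d L (Matrix.specialUnitaryGroup (Fin n) ℂ),
      |luscherV B (fun W => β * ambWilsonAction W) (Sk N) (WilsonFlow.coeConfig U)| ≤
        |β| ^ (N + 2) * (Module.finrank ℝ (Matrix (Fin n) (Fin n) ℂ) * (cW * max C 0) * ρ⁻¹ ^ N) *
          Fintype.card (Edge d L) := by
    intro U
    rw [IsLuscherSeries.luscherV_eq hser hser' hSk hsm' N U,
      luscherV_smul_pow B ambWilsonAction (wilsonSk d L B N) β N, abs_mul, abs_pow]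
    have hW := abs_luscherV_wilson_le B hcW0 (by positivity : (0 : ℝ) ≤ max C 0 * ρ⁻¹ ^ N) (hcW L) hG U
    calc |β| ^ (N + 2) * |luscherV B ambWilsonAction (wilsonSk d L B N) (WilsonFlow.coeConfig U)|
        ≤ |β| ^ (N + 2) * (Module.finrank ℝ (Matrix (Fin n) (Fin n) ℂ) * (cW * (max C 0 * ρ⁻¹ ^ N)) *
            Fintype.card (Edge d L)) := mul_le_mul_of_nonneg_left hW (pow_nonneg (abs_nonneg β) _)
      _ = |β| ^ (N + 2) * (Module.finrank ℝ (Matrix (Fin n) (Fin n) ℂ) * (cW * max C 0) * ρ⁻¹ ^ N) *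
            Fintype.card (Edge d L) := by ring
  exact flowSampler_of_defect_le B hS hSk hser N hK hΦ q hq hM

/-- **Log-depth law (conditional on Theorem A).**  If `LuscherGeometricGradientBound d n` holds then there are
`ρ > 0` and `D ≥ 0` such that: for every `0 < η < 1`, every `ε > 0`, every coupling in the geometric regime
`|β| ≤ (1 - η) ρ`, every periodic volume `L^d` and every truncation order
`N ≥ log(D ρ² |E| / ε) / (-log(1 - η))` — LOGARITHMIC in the number of links `|E| = d L^d` — the exact
order-`N` Wilson-flow sampler (any smooth solution of the recursion for `β S_W`, any flow of `-∂S̃^{[N]}_t`,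
output law `q`) has a weight `e^{-ε} ≤ w ≤ e^{ε}` with `w · q = π_β`, is exact, accepts from EVERY
configuration with probability `≥ e^{-ε}`, satisfies Doeblin `K(U,·) ≥ e^{-ε} π_β` and
`|μKᵗ(A) - π_β(A)| ≤ (1 - e^{-ε})ᵗ`.
[cite: Luscher2010Trivializing, §4.5(b)(c), §6] -/
theorem logDepthWilsonFlowSampler_of_geometric {d n : ℕ} (h : LuscherGeometricGradientBound d n) :
    ∃ ρ : ℝ, 0 < ρ ∧ ∃ D : ℝ, 0 ≤ D ∧
    ∀ (η ε : ℝ), 0 < η → η < 1 → 0 < ε → ∀ (β : ℝ), |β| ≤ (1 - η) * ρ →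
    ∀ (L : ℕ) [NeZero L] (N : ℕ),
      Real.log (D * ρ ^ 2 * Fintype.card (Edge d L) / ε) / -Real.log (1 - η) ≤ N →
    ∀ (B : SuBasis n) (Sk : ℕ → AmbConfig d L n → ℝ) (c : ℕ → ℝ),
      (∀ k, ContDiff ℝ ∞ (Sk k)) → IsLuscherSeries B (fun W => β * ambWilsonAction W) Sk c →
      ∀ (Φ : ℝ → GaugeConfig d L (Matrix.specialUnitaryGroup (Fin n) ℂ) →
          GaugeConfig d L (Matrix.specialUnitaryGroup (Fin n) ℂ)),
        IsFlowMap (fun t W => -linkGrad B (truncFlowAction Sk t N) W) Φ →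
      ∀ (q : Measure (GaugeConfig d L (Matrix.specialUnitaryGroup (Fin n) ℂ))) [IsProbabilityMeasure q],
        q = Measure.map (Φ 1) (trivialMeasure (Matrix.specialUnitaryGroup (Fin n) ℂ) d L) →
      ∃ w : GaugeConfig d L (Matrix.specialUnitaryGroup (Fin n) ℂ) → ℝ, Measurable w ∧
        (∀ U, Real.exp (-ε) ≤ w U) ∧ (∀ U, w U ≤ Real.exp ε) ∧
        (q.withDensity fun U => ENNReal.ofReal (w U)) =
          boltzmannMeasure (fun U : GaugeConfig d L (Matrix.specialUnitaryGroup (Fin n) ℂ) =>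
            β * ambWilsonAction (WilsonFlow.coeConfig U)) ∧
        Kernel.Invariant (indepMH q w)
          (boltzmannMeasure fun U : GaugeConfig d L (Matrix.specialUnitaryGroup (Fin n) ℂ) =>
            β * ambWilsonAction (WilsonFlow.coeConfig U)) ∧
        (∀ U, ENNReal.ofReal (Real.exp (-ε)) ≤ imhAcceptMass q w U) ∧
        (∀ (U : GaugeConfig d L (Matrix.specialUnitaryGroup (Fin n) ℂ))
          (A : Set (GaugeConfig d L (Matrix.specialUnitaryGroup (Fin n) ℂ))), MeasurableSet A →
          ENNReal.ofReal (Real.exp (-ε)) *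
              boltzmannMeasure (fun U : GaugeConfig d L (Matrix.specialUnitaryGroup (Fin n) ℂ) =>
                β * ambWilsonAction (WilsonFlow.coeConfig U)) A ≤ indepMH q w U A) ∧
        ∀ (μ : Measure (GaugeConfig d L (Matrix.specialUnitaryGroup (Fin n) ℂ))) [IsProbabilityMeasure μ]
          (t : ℕ) (A : Set (GaugeConfig d L (Matrix.specialUnitaryGroup (Fin n) ℂ))),
          |((fun m : Measure (GaugeConfig d L (Matrix.specialUnitaryGroup (Fin n) ℂ)) =>
                m.bind (indepMH q w))^[t] μ).real A -
              (boltzmannMeasure fun U : GaugeConfig d L (Matrix.specialUnitaryGroup (Fin n) ℂ) =>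
                β * ambWilsonAction (WilsonFlow.coeConfig U)).real A| ≤ (1 - Real.exp (-ε)) ^ t := by
  obtain ⟨ρ, hρ, D, hD0, hT⟩ := truncatedWilsonFlowSampler_of_geometric h
  refine ⟨ρ, hρ, D, hD0, ?_⟩
  intro η ε hη0 hη1 hε β hβ L _ N hN B Sk c hSk hser Φ hΦ q _ hq
  refine hT N β L B Sk c hSk hser Φ hΦ q hq ε ?_
  -- `2 |β|^{N+2} D ρ^{-N} |E| / (N+2) ≤ |β|^{N+2} D ρ^{-N} |E| ≤ D ρ² |E| (1-η)^N ≤ ε`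
  have hX0 : 0 ≤ |β| ^ (N + 2) * (D * ρ⁻¹ ^ N) * Fintype.card (Edge d L) := by positivity
  have hb0 : 0 ≤ |β| * ρ⁻¹ := by positivity
  have hb1 : |β| * ρ⁻¹ ≤ 1 - η := by
    rw [← div_eq_mul_inv, div_le_iff₀ hρ]; exact hβ
  have hb2 : |β| ≤ ρ :=
    calc |β| ≤ (1 - η) * ρ := hβ
      _ = ρ - η * ρ := by ring
      _ ≤ ρ := by linarith [mul_pos hη0 hρ]
  have hA := mul_pow_le_of_log_div_le (A := D * ρ ^ 2 * Fintype.card (Edge d L)) (by positivity)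
    hε hη0 hη1 hN
  have hX : |β| ^ (N + 2) * (D * ρ⁻¹ ^ N) * Fintype.card (Edge d L) ≤
      D * ρ ^ 2 * Fintype.card (Edge d L) * (1 - η) ^ N :=
    calc |β| ^ (N + 2) * (D * ρ⁻¹ ^ N) * Fintype.card (Edge d L)
        = D * Fintype.card (Edge d L) * (|β| ^ 2 * (|β| * ρ⁻¹) ^ N) := by ring
      _ ≤ D * Fintype.card (Edge d L) * (ρ ^ 2 * (1 - η) ^ N) := by gcongr
      _ = D * ρ ^ 2 * Fintype.card (Edge d L) * (1 - η) ^ N := by ring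
  have h2 : 2 * (|β| ^ (N + 2) * (D * ρ⁻¹ ^ N) * Fintype.card (Edge d L)) / (N + 2) ≤
      |β| ^ (N + 2) * (D * ρ⁻¹ ^ N) * Fintype.card (Edge d L) := by
    rw [div_le_iff₀ (by positivity)]
    nlinarith [mul_nonneg hX0 (Nat.cast_nonneg N : (0 : ℝ) ≤ N)]
  linarith

end Geometric

end Summit.Ventures.LatticeQCDFlow.TrivializingMaps
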